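import Summits.CriticalPhenomena.PercolationContinuityZ3.Theorems.PercNearOneGluingNoHeavyLowerTailSahiCombPrivate
import Summits.CriticalPhenomena.PercolationContinuityZ3.Theorems.PercNearOneGluingNoHeavyLowerTailSahiCombReadOnce

/-!
# The comb (tensor-Bernstein) hierarchy for Sahi's `E_k`, XVI: families with a SMALL CORE — `S`-determined families are read-once images of the cube `2^S`;
# (M⁺-3) for every triple of increasing events with a core of at most three coordinates

Support file of the one-cut programme (crux `NoHeavyLowerTail`, stmt-CriticalPhenomena-4575; cell `prim-masterthm`, seat P3, gen 3;
`run/shared/lean/prim/prim-masterthm/prim-masterthm-p3/HIERARCHY.md` §10).  Combines `…SahiCombPrivate` (private-coordinate elimination: a family with CORE `S` —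
every coordinate outside `S` affects at most one member — is comb-positive as soon as every family of increasing `S`-determined events is) with `…SahiCombReadOnce`
(read-once transport) and the kernel certificate of (M⁺-3) on at most three coins (`SahiC3CombCube.combPos_sahiE_three_of_card_le_three`, l12-p3 / prim-sahi).
* `exists_readOnce_of_determinedBy` — a family of `S`-determined events IS the read-once image (identity gadgets `{ω | s ∈ ω}`, `s ∈ S`) of a family of events of the
  cube `2^S` (`Set ↥S`), increasing if the original is;
* `combPos_of_determinedBy_of_cube` / `nonneg_of_determinedBy_of_cube` — hence every comb-level (resp. law-level) theorem about all families of the cube `2^S` holds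
  for all `S`-determined families of any cube (`S = ∅`: members are `∅` or `univ`);
* **`combPos_sahiE_three_of_core_le_three`** — **(M⁺-3), hence Kahn's Conjecture 5 for product measures, for every triple of increasing events of any finite cube whose
  pairwise-shared coordinates lie in a set of size `≤ 3`** (all other coordinates private to one member; no bound on the number of coordinates or on the members);
  law-level shadows `sahiE_three_nonneg_of_core_le_three`, `sahiE3_nonneg_of_core_le_three`.
The all-orders / four-coin companions (l12-p5's `native_decide` certificates) are in the computational file `…SahiCombCoreFour`.
HONEST FRAMING: nothing here asserts (M⁺-k) or `C_k` for `k ≥ 3` in general. [this work]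
-/

noncomputable section

open scoped Classical

namespace Summit.CriticalPhenomena.PercolationContinuityZ3.Theorems

open Finset Function MeasureTheory
open Literature.Combinatorics.Sahi2008
open Literature.Probability.LatticeModels (prodBernoulli sahiE3)
open Literature.Probability.LatticeModels.Kahn2022 (Affects)
open Literature.Probability.Percolation (DeterminedBy determinedBy_iff)
open Literature.Probability.Percolation.DecisionTree (ind ind_of_mem ind_of_not_mem ind_nonneg)
open Literature.Probability.Percolation.BHK2006 (weight)
open SahiComb SahiCombReadOnce SahiCombPrivate

namespace SahiCombCore

variable {ι : Type} [Fintype ι]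

/-! ### `S`-determined families are read-once images of the cube `2^S` -/

omit [Fintype ι] in
/-- **Transport**: a family of `S`-determined events (`S` nonempty) is the read-once substitution of the identity gadgets `{ω | s ∈ ω}` (`s ∈ S`) into a
family of events of the cube `Set ↥S`, increasing if the original is. [this work] -/
theorem exists_readOnce_of_determinedBy (S : Finset ι) (hS : S.Nonempty) {k : ℕ} (V : Fin k → Set (Set ι))
    (hV : ∀ j, DeterminedBy (V j) (↑S : Set ι)) :
    ∃ (π : ι → ↥S) (G : ↥S → Set (Set ι)) (U₀ : Fin k → Set (Set ↥S)),
      (∀ s, DeterminedBy (G s) {x | π x = s}) ∧ ((∀ j, IsUpperSet (V j)) → ∀ j, IsUpperSet (U₀ j)) ∧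
      ∀ j, {ω : Set ι | {s | ω ∈ G s} ∈ U₀ j} = V j := by
  obtain ⟨s₀, hs₀⟩ := hS
  let π : ι → ↥S := fun x => if h : x ∈ S then ⟨x, h⟩ else ⟨s₀, hs₀⟩
  let G : ↥S → Set (Set ι) := fun s => {ω : Set ι | (s : ι) ∈ ω}
  let lift : Set ↥S → Set ι := fun ξ => {x : ι | ∃ h : x ∈ S, (⟨x, h⟩ : ↥S) ∈ ξ}
  let U₀ : Fin k → Set (Set ↥S) := fun j => {ξ : Set ↥S | lift ξ ∈ V j}
  refine ⟨π, G, U₀, fun s => ?_, fun hVu j => ?_, fun j => ?_⟩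
  · rw [determinedBy_iff]
    intro ω ω' h
    have hs : (s : ι) ∈ {x : ι | π x = s} := by
      simp only [Set.mem_setOf_eq, π, dif_pos s.2]
    have h1 := Set.ext_iff.1 h (s : ι)
    simp only [Set.mem_inter_iff, hs, and_true] at h1
    exact h1
  · intro ξ ξ' hle hξ
    refine hVu j (fun x hx => ?_) hξ
    obtain ⟨hxS, hx⟩ := hx
    exact ⟨hxS, hle hx⟩
  · ext ω
    simp only [Set.mem_setOf_eq, U₀, G, lift]
    have hlift : {x : ι | ∃ h : x ∈ S, (x : ι) ∈ ω} = ω ∩ ↑S := by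
      ext x; simp only [Set.mem_setOf_eq, Set.mem_inter_iff, Finset.mem_coe]; tauto
    rw [hlift]
    exact (determinedBy_iff _ _).1 (hV j) _ _ (by rw [Set.inter_assoc, Set.inter_self])

/-- `E_k` of a family with an EMPTY member vanishes. [folklore] -/
theorem sahiE_ind_eq_zero_of_eq_empty {α : Type*} [Fintype α] (μ : α → ℝ) {k : ℕ} (V : Fin k → Set α) {j : Fin k} (hj : V j = ∅) :
    sahiE μ k (fun i => ind (V i)) = 0 := by
  have hfam : (fun i => ind (V i)) = update (fun i => ind (V i)) j ((0 : ℝ) • fun _ => (0 : ℝ)) := by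
    funext i
    by_cases hij : i = j
    · subst hij; rw [update_self]; funext x; rw [hj]; simp [ind_of_not_mem (Set.notMem_empty x)]
    · rw [update_of_ne hij]
  rw [hfam, sahiE_update_smul, zero_mul]

/-- Families of `∅`-determined events (each member `∅` or `univ`) are comb-positive at every order. [this work] -/
theorem combPos_sahiE_ind_of_determinedBy_empty {k : ℕ} (V : Fin k → Set (Set ι)) (hV : ∀ j, DeterminedBy (V j) (↑(∅ : Finset ι) : Set ι)) :
    CombPos (fun _ : ι => k) (fun p => sahiE (bernoulliWeight p) k (fun j => ind (V j))) := by
  by_cases h : ∃ j, V j = ∅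
  · obtain ⟨j, hj⟩ := h
    exact (CombPos.zero _).congr fun p => sahiE_ind_eq_zero_of_eq_empty _ V hj
  · have hall : ∀ j, V j = {ω : Set ι | (∅ : Set ι) ⊆ ω} := fun j => by
      rcases eq_empty_or_univ_of_determinedBy_empty (hV j) with h0 | h1
      · exact absurd ⟨j, h0⟩ h
      · rw [h1]; ext ω; simp
    refine (combPos_sahiE_ind_of_cylinders (ι := ι) (fun _ : Fin k => (∅ : Set ι))).congr fun p => ?_
    congr 1; funext j; rw [hall j]

/-- **Every comb-level cube theorem transfers to `S`-determined families**: if all families of `k` increasing events of the cube `Set ↥S` are comb-positive at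
multidegree `k`, so is every family of `k` increasing `S`-determined events of `ι`. [this work] -/
theorem combPos_of_determinedBy_of_cube (S : Finset ι) {k : ℕ}
    (hcube : ∀ W : Fin k → Set (Set ↥S), (∀ j, IsUpperSet (W j)) →
      CombPos (fun _ : ↥S => k) (fun p => sahiE (bernoulliWeight p) k (fun j => ind (W j))))
    (V : Fin k → Set (Set ι)) (hVu : ∀ j, IsUpperSet (V j)) (hV : ∀ j, DeterminedBy (V j) (↑S : Set ι)) :
    CombPos (fun _ : ι => k) (fun p => sahiE (bernoulliWeight p) k (fun j => ind (V j))) := by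
  rcases S.eq_empty_or_nonempty with hS | hS
  · subst hS; exact combPos_sahiE_ind_of_determinedBy_empty V hV
  · obtain ⟨π, G, U₀, hG, hU₀, heq⟩ := exists_readOnce_of_determinedBy S hS V hV
    refine (CombPos.readOnce π G hG (hcube U₀ (hU₀ hVu))).congr fun p => ?_
    congr 1; funext j; rw [heq j]

/-- **Every law-level cube theorem transfers to `S`-determined families.** [this work] -/
theorem nonneg_of_determinedBy_of_cube (S : Finset ι) {k : ℕ}
    (hcube : ∀ (W : Fin k → Set (Set ↥S)), (∀ j, IsUpperSet (W j)) → ∀ c : ↥S → unitInterval,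
      0 ≤ sahiE (bernoulliWeight c) k (fun j => ind (W j)))
    (V : Fin k → Set (Set ι)) (hVu : ∀ j, IsUpperSet (V j)) (hV : ∀ j, DeterminedBy (V j) (↑S : Set ι)) (q : ι → unitInterval) :
    0 ≤ sahiE (bernoulliWeight q) k (fun j => ind (V j)) := by
  rcases S.eq_empty_or_nonempty with hS | hS
  · subst hS; exact (combPos_sahiE_ind_of_determinedBy_empty V hV).nonneg q
  · obtain ⟨π, G, U₀, hG, hU₀, heq⟩ := exists_readOnce_of_determinedBy S hS V hV
    have h := sahiE_readOnce_eq π G hG q U₀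
    simp only [heq] at h
    let c : ↥S → unitInterval := fun s => ⟨(prodBernoulli q).real (G s), measureReal_nonneg, measureReal_le_one⟩
    have hw : (weight fun s => (prodBernoulli q).real (G s)) = bernoulliWeight c := rfl
    rw [h, hw]
    exact hcube U₀ (hU₀ hVu) c

/-! ### (M⁺-3) for triples with a core of at most three coordinates -/

/-- (M⁺-3) for every triple of increasing events of a cube with at most three coordinates, family form (kernel certificate
`SahiC3CombCube.combPos_sahiE_three_of_card_le_three`). [this work] -/
theorem combPos_sahiE_three_fam_of_card_le_three {κ : Type} [Fintype κ] (hκ : Fintype.card κ ≤ 3) (W : Fin 3 → Set (Set κ))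
    (hW : ∀ j, IsUpperSet (W j)) : CombPos (fun _ : κ => 3) (fun p => sahiE (bernoulliWeight p) 3 (fun j => ind (W j))) := by
  refine (SahiC3CombCube.combPos_sahiE_three_of_card_le_three hκ (hW 0) (hW 1) (hW 2)).congr fun p => ?_
  congr 1; funext j; fin_cases j <;> rfl

/-- **(M⁺-3) FOR TRIPLES WITH A CORE OF AT MOST THREE COORDINATES.**  Let `U_0, U_1, U_2` be increasing events of a finite cube and `S` a set of at most three
coordinates such that every coordinate outside `S` affects at most one of the `U_j`.  Then `p ↦ E_3(μ_p; 1_{U_0},1_{U_1},1_{U_2})` is a nonnegative combination of the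
degree-3 tensor-Bernstein basis (no bound on the number of coordinates, nor on the events beyond the core condition). [this work] -/
theorem combPos_sahiE_three_of_core_le_three (S : Finset ι) (hS3 : S.card ≤ 3) (U : Fin 3 → Set (Set ι)) (hU : ∀ j, IsUpperSet (U j))
    (hpriv : ∀ e, e ∉ S → ∀ j j', Affects (U j) e → Affects (U j') e → j = j') :
    CombPos (fun _ : ι => 3) (fun p => sahiE (bernoulliWeight p) 3 (fun j => ind (U j))) :=
  combPos_sahiE_ind_of_core' S (fun V hVu hVd => combPos_of_determinedBy_of_cube S
    (fun W hW => combPos_sahiE_three_fam_of_card_le_three (by rw [Fintype.card_coe]; exact hS3) W hW) V hVu hVd) U hU hpriv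

/-- Law-level shadow (functional form): Sahi's `E_3(μ_p) ≥ 0` for triples with a core of at most three coordinates. [this work] -/
theorem sahiE_three_nonneg_of_core_le_three (p : ι → unitInterval) (S : Finset ι) (hS3 : S.card ≤ 3) (U : Fin 3 → Set (Set ι))
    (hU : ∀ j, IsUpperSet (U j)) (hpriv : ∀ e, e ∉ S → ∀ j j', Affects (U j) e → Affects (U j') e → j = j') :
    0 ≤ sahiE (bernoulliWeight p) 3 (fun j => ind (U j)) :=
  (combPos_sahiE_three_of_core_le_three S hS3 U hU hpriv).nonneg p

/-- **Kahn's Conjecture 5 / Sahi's `C_3` (product measures) for triples with a core of at most three coordinates**, event form: for increasing `A, B, C` of a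
finite cube such that the coordinates affecting at least two of them number at most three, `sahiE3 (prodBernoulli p) A B C ≥ 0`. [this work] -/
theorem sahiE3_nonneg_of_core_le_three (p : ι → unitInterval) (S : Finset ι) (hS3 : S.card ≤ 3) {A B C : Set (Set ι)}
    (hA : IsUpperSet A) (hB : IsUpperSet B) (hC : IsUpperSet C)
    (hpriv : ∀ e, e ∉ S → ∀ j j' : Fin 3, Affects (![A, B, C] j) e → Affects (![A, B, C] j') e → j = j') :
    0 ≤ sahiE3 (prodBernoulli p) A B C := by
  have h := sahiE_three_nonneg_of_core_le_three p S hS3 ![A, B, C]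
    (fun j => by fin_cases j <;> assumption) hpriv
  have hfam : (fun j => ind ((![A, B, C] : Fin 3 → Set (Set ι)) j)) = ![ind A, ind B, ind C] := by
    funext j; fin_cases j <;> rfl
  rwa [hfam, sahiE_three_ind] at h

end SahiCombCore

end Summit.CriticalPhenomena.PercolationContinuityZ3.Theorems

end
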